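import Mathlib
import HarnessLib.Audit
import Summits.PneNP.PneNP.Theorems.PstarChordBridgeFundamental
import Summits.PneNP.PneNP.Theorems.PstarNorUnitCoverTools
import Summits.PneNP.PneNP.Theorems.PstarChordEndgameTools

/-!
# Two fundamental cycles differing through ONE AND variable: triangle or square (ROUND-25, O2 / E2 CASE T structure; prover-1 g18)

FRONTIER range-avoidance ladder, rung F-N3 (`stmt-PneNP-19007`), cell `pnp-ideate` (this seat's `HOME/pnp-ideate-prover-1/g18/E2-PLAN.md` §4 (T1));
restricted-model proof complexity — nothing here bears on `P` versus `NP`.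

Pure XOR-multigraph combinatorics behind CASE T of the one-gate configuration.  `PstarGateCaseTLocal.caseT_fibre_dichotomy` (EQ branch) says that the
fundamental sets of the gated chord `e` and of any other chord `e'` differ only by edges THROUGH THE GATE PARTNER `u`:
`∀ j ∈ D e ∆ D e', u ∈ andPair j`.  Since `D e + e` and `D e' + e'` are everywhere even and the outputs through `u` form an XOR-MATCHING (simple
overlaps), the difference `M := D e ∆ D e'` is pinned down:

* `matching_of_through` — distinct outputs whose AND pairs contain `u` have disjoint XOR pairs;
* `parity_of_symmDiff` — for every XOR variable `w`: `[w ∈ xverts M] = [w ∈ xpair e] + [w ∈ xpair e']` in `𝔽₂` — a vertex of `M` is an endpoint of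
  EXACTLY ONE of `e, e'`, every other vertex is an endpoint of both or of neither;
* `card_symmDiff_le_two` — hence `#M ≤ 2` (and `M ≠ ∅` unless `e = e'`, `PstarChordBridgeFundamental.eq_of_fundamental_eq`): `{e, e'} ∪ M` is a
  TRIANGLE through one `u`-edge or a SQUARE through two — so the chords of CASE T are confined to the `K₄` spanned by `e` and the (at most two)
  `u`-edges at its endpoints.
-/

set_option linter.dupNamespace false -- `Summit.PneNP.PneNP.…`: summit = sub-problem name (D-0017 single-conjunct layout)

open Finset Literature.Computability.Complexity
open scoped symmDiff
open Summit.PneNP.PneNP.Theorems.PstarSALevel (varSet SimpleOverlap)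
open Summit.PneNP.PneNP.Theorems.PstarXCore (xpair xverts mem_xpair)
open Summit.PneNP.PneNP.Theorems.PstarCentreFree (vars_mem_varSet)
open Summit.PneNP.PneNP.Theorems.PstarChordBridgeTools (xpdeg)
open Summit.PneNP.PneNP.Theorems.PstarChordEndgameTools (not_two_shared)
open Summit.PneNP.PneNP.Theorems.PstarGraphQuadGapTwoForms (sum_symmDiff_zmod2)
open Summit.PneNP.PneNP.Theorems.PstarNorUnitCoverTools (even_xpdeg_iff)

namespace Summit.PneNP.PneNP.Theorems.PstarGateCaseTCycle

variable {n m : ℕ}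

/-- The XOR-incidence indicator of output `j` at the variable `w`, in `𝔽₂`. -/
def xind (I : LocalMap 4 n m) (j : Fin m) (w : Fin n) : ZMod 2 :=
  (if I.vars j 0 = w then 1 else 0) + (if I.vars j 1 = w then 1 else 0)

/-- For a pure output the indicator is `[w ∈ xpair j]`. -/
theorem xind_eq (I : LocalMap 4 n m) (hI : I.IsPure xorAndPred) (j : Fin m) (w : Fin n) :
    xind I j w = if w ∈ xpair I j then 1 else 0 := by
  unfold xind
  have h01 : I.vars j 0 ≠ I.vars j 1 := fun h => absurd (hI.2 j h) (by decide)
  by_cases h0 : I.vars j 0 = w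
  · have h1 : I.vars j 1 ≠ w := fun h => h01 (h0.trans h.symm)
    rw [if_pos h0, if_neg h1, add_zero, if_pos ((mem_xpair I).2 (Or.inl h0.symm))]
  · by_cases h1 : I.vars j 1 = w
    · rw [if_neg h0, if_pos h1, zero_add, if_pos ((mem_xpair I).2 (Or.inr h1.symm))]
    · rw [if_neg h0, if_neg h1, add_zero, if_neg]
      intro h
      rcases (mem_xpair I).1 h with h | h
      · exact h0 h.symm
      · exact h1 h.symm

/-- Evenness of all slot-degrees of `insert e D`, as an identity of indicators: `Σ_{j ∈ D} xind j w = xind e w`. -/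
theorem sum_xind_of_even (I : LocalMap 4 n m) {D : Finset (Fin m)} {e : Fin m} (he : e ∉ D) (heven : ∀ w, Even (xpdeg I (insert e D) w))
    (w : Fin n) : ∑ j ∈ D, xind I j w = xind I e w := by
  have h := (even_xpdeg_iff I (insert e D) w).1 (heven w)
  rw [sum_insert he] at h
  unfold xind
  have e2 : ∀ a b : ZMod 2, a + b = 0 → b = a := by decide
  exact e2 _ _ h

/-- **Outputs through a common AND variable form an XOR-matching**: two distinct outputs whose AND pairs contain `u` have disjoint XOR pairs. -/
theorem matching_of_through (I : LocalMap 4 n m) (hI : I.IsPure xorAndPred) (hS : SimpleOverlap I) {j j' : Fin m} (hne : j ≠ j') {u : Fin n}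
    (hj : I.vars j 2 = u ∨ I.vars j 3 = u) (hj' : I.vars j' 2 = u ∨ I.vars j' 3 = u) {w : Fin n} (hw : w ∈ xpair I j) : w ∉ xpair I j' := by
  intro hw'
  have hu : u ∈ varSet I j := by rcases hj with h | h <;> rw [← h] <;> exact vars_mem_varSet I j _
  have hu' : u ∈ varSet I j' := by rcases hj' with h | h <;> rw [← h] <;> exact vars_mem_varSet I j' _
  have hxs : ∀ {i : Fin m} {v : Fin n}, v ∈ xpair I i → v ∈ varSet I i := by
    intro i v hv
    rcases (mem_xpair I).1 hv with rfl | rfl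
    · exact vars_mem_varSet I i 0
    · exact vars_mem_varSet I i 1
  -- `u ≠ w`: `u` is an AND slot of `j`, `w` an XOR slot
  have huw : u ≠ w := by
    intro huw
    rcases (mem_xpair I).1 hw with h0 | h1
    · rcases hj with h | h
      · exact absurd (hI.2 j (h.trans (huw.trans h0))) (by decide)
      · exact absurd (hI.2 j (h.trans (huw.trans h0))) (by decide)
    · rcases hj with h | h
      · exact absurd (hI.2 j (h.trans (huw.trans h1))) (by decide)
      · exact absurd (hI.2 j (h.trans (huw.trans h1))) (by decide)
  exact not_two_shared I hS hne huw hu hu' (hxs hw) (hxs hw')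

/-- The indicator sum over an XOR-matching is the indicator of its vertex set. -/
theorem sum_xind_of_matching (I : LocalMap 4 n m) (hI : I.IsPure xorAndPred) (hS : SimpleOverlap I) {M : Finset (Fin m)} {u : Fin n}
    (hM : ∀ j ∈ M, I.vars j 2 = u ∨ I.vars j 3 = u) (w : Fin n) :
    ∑ j ∈ M, xind I j w = if w ∈ xverts I M then 1 else 0 := by
  classical
  simp only [xind_eq I hI]
  rw [sum_boole]
  by_cases hw : w ∈ xverts I M
  · rw [if_pos hw]
    obtain ⟨j, hj, hwj⟩ : ∃ j ∈ M, w ∈ xpair I j := by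
      unfold PstarXCore.xverts at hw; exact mem_biUnion.1 hw
    have h1 : (M.filter fun i => w ∈ xpair I i) = {j} := by
      refine eq_singleton_iff_unique_mem.2 ⟨mem_filter.2 ⟨hj, hwj⟩, fun i hi => ?_⟩
      obtain ⟨hiM, hwi⟩ := mem_filter.1 hi
      by_contra hij
      exact matching_of_through I hI hS hij (hM i hiM) (hM j hj) hwi hwj
    rw [h1, card_singleton, Nat.cast_one]
  · rw [if_neg hw]
    have h0 : (M.filter fun i => w ∈ xpair I i) = ∅ := by
      refine filter_eq_empty_iff.2 fun i hi hwi => hw ?_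
      unfold PstarXCore.xverts; exact mem_biUnion.2 ⟨i, hi, hwi⟩
    rw [h0, card_empty, Nat.cast_zero]

/-- **Parity of the difference.**  If `D + e` and `D' + e'` are everywhere even and every edge of `M = D ∆ D'` passes through `u`, then for every
variable `w`: `[w ∈ xverts M] = [w ∈ xpair e] + [w ∈ xpair e']` in `𝔽₂`. -/
theorem parity_of_symmDiff (I : LocalMap 4 n m) (hI : I.IsPure xorAndPred) (hS : SimpleOverlap I) {D D' : Finset (Fin m)} {e e' : Fin m}
    (he : e ∉ D) (he' : e' ∉ D') (heven : ∀ w, Even (xpdeg I (insert e D) w)) (heven' : ∀ w, Even (xpdeg I (insert e' D') w))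
    {u : Fin n} (hM : ∀ j ∈ D ∆ D', I.vars j 2 = u ∨ I.vars j 3 = u) (w : Fin n) :
    (if w ∈ xverts I (D ∆ D') then (1 : ZMod 2) else 0) = (if w ∈ xpair I e then 1 else 0) + (if w ∈ xpair I e' then 1 else 0) := by
  rw [← sum_xind_of_matching I hI hS hM w, sum_symmDiff_zmod2, sum_xind_of_even I he heven w, sum_xind_of_even I he' heven' w,
    xind_eq I hI, xind_eq I hI]

/-- A vertex of the difference is an endpoint of exactly one of `e, e'`. -/
theorem mem_xpair_xor_of_mem_xverts (I : LocalMap 4 n m) (hI : I.IsPure xorAndPred) (hS : SimpleOverlap I) {D D' : Finset (Fin m)} {e e' : Fin m}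
    (he : e ∉ D) (he' : e' ∉ D') (heven : ∀ w, Even (xpdeg I (insert e D) w)) (heven' : ∀ w, Even (xpdeg I (insert e' D') w))
    {u : Fin n} (hM : ∀ j ∈ D ∆ D', I.vars j 2 = u ∨ I.vars j 3 = u) {w : Fin n} (hw : w ∈ xverts I (D ∆ D')) :
    (w ∈ xpair I e ∧ w ∉ xpair I e') ∨ (w ∉ xpair I e ∧ w ∈ xpair I e') := by
  have h := parity_of_symmDiff I hI hS he he' heven heven' hM w
  rw [if_pos hw] at h
  by_cases h1 : w ∈ xpair I e <;> by_cases h2 : w ∈ xpair I e'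
  · rw [if_pos h1, if_pos h2] at h; exact absurd h (by decide)
  · exact Or.inl ⟨h1, h2⟩
  · exact Or.inr ⟨h1, h2⟩
  · rw [if_neg h1, if_neg h2] at h; exact absurd h (by decide)

/-- A vertex off the difference is an endpoint of both of `e, e'` or of neither. -/
theorem mem_xpair_iff_of_not_mem_xverts (I : LocalMap 4 n m) (hI : I.IsPure xorAndPred) (hS : SimpleOverlap I) {D D' : Finset (Fin m)}
    {e e' : Fin m} (he : e ∉ D) (he' : e' ∉ D') (heven : ∀ w, Even (xpdeg I (insert e D) w)) (heven' : ∀ w, Even (xpdeg I (insert e' D') w))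
    {u : Fin n} (hM : ∀ j ∈ D ∆ D', I.vars j 2 = u ∨ I.vars j 3 = u) {w : Fin n} (hw : w ∉ xverts I (D ∆ D')) :
    w ∈ xpair I e ↔ w ∈ xpair I e' := by
  have h := parity_of_symmDiff I hI hS he he' heven heven' hM w
  rw [if_neg hw] at h
  by_cases h1 : w ∈ xpair I e <;> by_cases h2 : w ∈ xpair I e'
  · exact ⟨fun _ => h2, fun _ => h1⟩
  · rw [if_pos h1, if_neg h2] at h; exact absurd h (by decide)
  · rw [if_neg h1, if_pos h2] at h; exact absurd h (by decide)
  · exact ⟨fun h => absurd h h1, fun h => absurd h h2⟩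

/-- The vertex set of an XOR-matching has twice as many elements as the matching. -/
theorem card_xverts_of_matching (I : LocalMap 4 n m) (hI : I.IsPure xorAndPred) (hS : SimpleOverlap I) {M : Finset (Fin m)} {u : Fin n}
    (hM : ∀ j ∈ M, I.vars j 2 = u ∨ I.vars j 3 = u) : (xverts I M).card = 2 * M.card := by
  classical
  unfold PstarXCore.xverts
  rw [card_biUnion]
  · have h2 : ∀ j ∈ M, (xpair I j).card = 2 := fun j _ => by
      unfold PstarXCore.xpair
      exact card_pair fun h => absurd (hI.2 j h) (by decide)
    rw [sum_congr rfl h2, sum_const, smul_eq_mul, mul_comm]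
  · intro j hj j' hj' hne
    exact disjoint_left.2 fun w hw hw' => matching_of_through I hI hS hne (hM j hj) (hM j' hj') hw hw'

/-- **The difference has at most two edges**: `{e, e'} ∪ (D ∆ D')` is a triangle or a square. -/
theorem card_symmDiff_le_two (I : LocalMap 4 n m) (hI : I.IsPure xorAndPred) (hS : SimpleOverlap I) {D D' : Finset (Fin m)} {e e' : Fin m}
    (he : e ∉ D) (he' : e' ∉ D') (heven : ∀ w, Even (xpdeg I (insert e D) w)) (heven' : ∀ w, Even (xpdeg I (insert e' D') w))
    {u : Fin n} (hM : ∀ j ∈ D ∆ D', I.vars j 2 = u ∨ I.vars j 3 = u) : (D ∆ D').card ≤ 2 := by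
  classical
  -- the vertices of the difference lie in `xpair e ∪ xpair e'`
  have hsub : xverts I (D ∆ D') ⊆ xpair I e ∪ xpair I e' := by
    intro w hw
    rcases mem_xpair_xor_of_mem_xverts I hI hS he he' heven heven' hM hw with ⟨h, -⟩ | ⟨-, h⟩
    · exact mem_union_left _ h
    · exact mem_union_right _ h
  have h4 : (xpair I e ∪ xpair I e').card ≤ 4 := by
    refine (card_union_le _ _).trans ?_
    unfold PstarXCore.xpair
    exact Nat.add_le_add card_le_two card_le_two
  have h := card_xverts_of_matching I hI hS hM
  have := (card_le_card hsub).trans h4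
  omega

end Summit.PneNP.PneNP.Theorems.PstarGateCaseTCycle
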